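import Literature.Analysis.FluidPDE.ConvexIntegration2DIterationEstimates
import HarnessLib

/-!
# Convex integration in 2-D: the strong limit of the iteration

Topic `Analysis/FluidPDE`. Support file (layer 5b of 5) for the proof of
`ConvexIntegrationLemma2DBall` (Chiodaroli–De Lellis–Kreml 2015, Lemma 3.7 on a ball): for a run
`d : IterData` of the iteration of `ConvexIntegration2DIteration.lean` (estimates in
`ConvexIntegration2DIterationEstimates.lean`),

* `sub`: a strictly increasing subsequence along which `‖p_{φ(i+1)} - p_{φ i}‖²_{L²} < 4^{-i}`,
  hence (`integral_abs_sub_le`, AM–GM on the bounded `Ω`) summable `L¹` increments and a.e.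
  convergence (`ae_tendsto_sub`); `P` — the measurable a.e. limit, `limState = qt + P`;
* `ae_limit_props` (bounded, vanishing off `Ω`, `M ⪰ 0`), `ae_trM_limState_eq_zero`
  (`|ṽ + v̲|² = C` a.e. on `Ω`, from `J_{φ i} → 0` by dominated convergence — CDK (Con) ⇒ (iii)),
  `limit_weak_div/mom₁/mom₂` (the linear system (ii) passes to the limit by dominated
  convergence), `abs_integral_obs_le` (`|∫ (P_c - p₀,c) g| ≤ θ`, the observable that will tell
  different runs apart).

## References

* E. Chiodaroli, C. De Lellis, O. Kreml, *Global ill-posedness of the isentropic system of gas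
  dynamics*, Comm. Pure Appl. Math. 68 (2015) 1157–1190, §4.1.
-/

noncomputable section

open MeasureTheory Set Metric Filter Function
open scoped ContDiff Topology NNReal

namespace Literature.Analysis.FluidPDE.ConvexIntegration

namespace IterData

variable (d : IterData)

/-! ### A rapidly Cauchy subsequence and its almost-everywhere limit -/

/-- Thresholds `M i` beyond which `‖p_m - p_n‖² < 4^{-i}`. [folklore] -/
def thr (i : ℕ) : ℕ := Classical.choose (d.cauchy (η := (1 / 4) ^ i) (by positivity))

/-- The defining property of the thresholds. [folklore] -/
theorem thr_spec (i : ℕ) : ∀ n m, d.thr i ≤ n → n ≤ m →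
    ip (fun c z => d.state m c z - d.state n c z) (fun c z => d.state m c z - d.state n c z)
      < (1 / 4) ^ i :=
  Classical.choose_spec (d.cauchy (η := (1 / 4) ^ i) (by positivity))

/-- The subsequence `φ`: `φ 0 = M 0`, `φ (i+1) = max (M (i+1)) (φ i + 1)`. [folklore] -/
def sub : ℕ → ℕ
  | 0 => d.thr 0
  | i + 1 => max (d.thr (i + 1)) (sub i + 1)

/-- The subsequence dominates the thresholds. [folklore] -/
theorem thr_le_sub (i : ℕ) : d.thr i ≤ d.sub i := by
  cases i with
  | zero => exact le_rfl
  | succ i => exact le_max_left _ _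

/-- The subsequence is strictly increasing, step by step. [folklore] -/
theorem sub_lt_sub_succ (i : ℕ) : d.sub i < d.sub (i + 1) :=
  Nat.lt_of_lt_of_le (Nat.lt_succ_self _) (le_max_right _ _)

/-- The subsequence is strictly increasing. [folklore] -/
theorem sub_strictMono : StrictMono d.sub := strictMono_nat_of_lt_succ d.sub_lt_sub_succ

/-- The subsequence tends to infinity. [folklore] -/
theorem tendsto_sub : Tendsto d.sub atTop atTop := d.sub_strictMono.tendsto_atTop

/-- `∫ (p_{φ(i+1),c} - p_{φ i,c})² < 4^{-i}`. [folklore] -/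
theorem integral_sq_sub_lt (i : ℕ) (c : Fin 4) :
    ∫ z, (d.state (d.sub (i + 1)) c z - d.state (d.sub i) c z) ^ 2 < (1 / 4) ^ i := by
  have h := d.thr_spec i (d.sub i) (d.sub (i + 1)) (d.thr_le_sub i) (d.sub_lt_sub_succ i).le
  refine lt_of_le_of_lt ?_ h
  unfold ip
  have : ∫ z, (d.state (d.sub (i + 1)) c z - d.state (d.sub i) c z) ^ 2
      = ∫ z, (d.state (d.sub (i + 1)) c z - d.state (d.sub i) c z)
        * (d.state (d.sub (i + 1)) c z - d.state (d.sub i) c z) := by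
    simp only [sq]
  rw [this]
  exact Finset.single_le_sum (f := fun c => ∫ z, (d.state (d.sub (i + 1)) c z - d.state (d.sub i) c z)
    * (d.state (d.sub (i + 1)) c z - d.state (d.sub i) c z))
    (fun c _ => integral_nonneg fun z => mul_self_nonneg _) (Finset.mem_univ c)

/-- The summable `L¹` bounds `b_i = 2^{-i}(1 + |Ω|)/2`. [folklore] -/
def bnd (i : ℕ) : ℝ := (1 / 2) ^ i * ((1 + volume.real d.Ω) / 2)

/-- The `L¹` bounds are summable. [folklore] -/
theorem summable_bnd : Summable d.bnd :=
  (summable_geometric_of_lt_one (by norm_num) (by norm_num)).mul_right _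

/-- **`L¹` control of the subsequence increments** (from `L²` via `|x| ≤ (t x² + t⁻¹)/2` on the
bounded set `Ω`). [folklore] -/
theorem integral_abs_sub_le (i : ℕ) (c : Fin 4) :
    ∫ z, |d.state (d.sub (i + 1)) c z - d.state (d.sub i) c z| ≤ d.bnd i := by
  set D : ST → ℝ := fun z => d.state (d.sub (i + 1)) c z - d.state (d.sub i) c z with hD
  have hDc : Continuous D := (d.state_continuous _ c).sub (d.state_continuous _ c)
  have hDcs : HasCompactSupport D := (d.state_hasCompactSupport _ c).sub (d.state_hasCompactSupport _ c)
  have hDz : ∀ z, z ∉ d.Ω → D z = 0 := fun z hz => by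
    simp [hD, d.state_eq_zero _ hz c]
  have hΩ : volume d.Ω < ⊤ := d.hΩb.measure_lt_top
  haveI : IsFiniteMeasure (volume.restrict d.Ω) := isFiniteMeasure_restrict.mpr hΩ.ne
  set t : ℝ := 2 ^ i with ht
  have htpos : 0 < t := by positivity
  -- pointwise AM–GM on `Ω`
  have hpt : ∀ z, |D z| ≤ (t * D z ^ 2 + 1 / t) / 2 := by
    intro z
    have h1 : 0 ≤ (t * |D z| - 1) ^ 2 := sq_nonneg _
    have h2 : |D z| ^ 2 = D z ^ 2 := sq_abs _
    rw [le_div_iff₀ (by norm_num : (0 : ℝ) < 2)]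
    have : t * D z ^ 2 + 1 / t - |D z| * 2 = (t * |D z| - 1) ^ 2 / t := by
      field_simp; rw [← h2]; ring
    nlinarith [this ▸ div_nonneg h1 htpos.le]
  have hI2 : Integrable (fun z => D z ^ 2) := by
    simpa [sq] using integrable_mul_of_cs hDc hDcs hDc
  have hsq : ∫ z, D z ^ 2 < (1 / 4) ^ i := d.integral_sq_sub_lt i c
  calc ∫ z, |D z| = ∫ z in d.Ω, |D z| := by
        rw [setIntegral_eq_integral_of_forall_compl_eq_zero fun z hz => by rw [hDz z hz, abs_zero]]
    _ ≤ ∫ z in d.Ω, (t * D z ^ 2 + 1 / t) / 2 := by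
        refine setIntegral_mono_on ?_ ?_ d.hΩo.measurableSet fun z _ => hpt z
        · exact (hDc.abs.integrable_of_hasCompactSupport hDcs.abs).integrableOn
        · exact (((hI2.const_mul t).integrableOn).add ((integrableOn_const_iff).mpr (Or.inr hΩ))).div_const 2
    _ = (t * (∫ z in d.Ω, D z ^ 2) + volume.real d.Ω * (1 / t)) / 2 := by
        have i1 : IntegrableOn (fun z => t * D z ^ 2) d.Ω volume := (hI2.const_mul t).integrableOn
        have i2 : IntegrableOn (fun _ => (1 / t : ℝ)) d.Ω volume :=
          (integrableOn_const_iff).mpr (Or.inr hΩ)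
        rw [integral_div, integral_add i1 i2, integral_const_mul, setIntegral_const, smul_eq_mul]
    _ ≤ (t * (1 / 4) ^ i + volume.real d.Ω * (1 / t)) / 2 := by
        have : ∫ z in d.Ω, D z ^ 2 ≤ (1 / 4) ^ i := by
          rw [setIntegral_eq_integral_of_forall_compl_eq_zero fun z hz => by rw [hDz z hz]; ring]
          exact hsq.le
        gcongr
    _ = d.bnd i := by
        simp only [bnd, ht]
        have e1 : (2 : ℝ) ^ i * (1 / 4) ^ i = (1 / 2) ^ i := by
          rw [← mul_pow]; norm_num
        have e2 : (1 : ℝ) / 2 ^ i = (1 / 2) ^ i := by rw [one_div, one_div, inv_pow]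
        rw [e1, e2]; ring

/-- Almost everywhere convergence of each component along the subsequence. [folklore] -/
theorem ae_tendsto_sub (c : Fin 4) :
    ∀ᵐ z, ∃ l : ℝ, Tendsto (fun i => d.state (d.sub i) c z) atTop (𝓝 l) :=
  ae_exists_tendsto_of_summable_integral (fun _ => d.state_continuous _ c)
    (fun _ => ((d.state_continuous _ c).sub (d.state_continuous _ c)).integrable_of_hasCompactSupport
      ((d.state_hasCompactSupport _ c).sub (d.state_hasCompactSupport _ c)))
    d.summable_bnd (fun i => d.integral_abs_sub_le i c)

/-- **The limit perturbation** `P = lim p_{φ i}` (a.e. and componentwise), chosen measurable.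
[cite: ChiodaroliDeLellisKreml2015, §4.1 (the limit `(v̲, u̲) ∈ X`)] -/
def P (c : Fin 4) : ST → ℝ :=
  Classical.choose (measurable_limit_of_tendsto_metrizable_ae (L := atTop)
    (fun i => (d.state_continuous (d.sub i) c).measurable.aemeasurable) (d.ae_tendsto_sub c))

/-- The limit is measurable. [folklore] -/
theorem measurable_P (c : Fin 4) : Measurable (d.P c) :=
  (Classical.choose_spec (measurable_limit_of_tendsto_metrizable_ae (L := atTop)
    (fun i => (d.state_continuous (d.sub i) c).measurable.aemeasurable) (d.ae_tendsto_sub c))).1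

/-- The subsequence converges to the limit a.e., componentwise. [folklore] -/
theorem ae_tendsto_P (c : Fin 4) :
    ∀ᵐ z, Tendsto (fun i => d.state (d.sub i) c z) atTop (𝓝 (d.P c z)) :=
  (Classical.choose_spec (measurable_limit_of_tendsto_metrizable_ae (L := atTop)
    (fun i => (d.state_continuous (d.sub i) c).measurable.aemeasurable) (d.ae_tendsto_sub c))).2

/-- The subsequence converges to the limit a.e., all components at once. [folklore] -/
theorem ae_tendsto_P_all : ∀ᵐ z, ∀ c, Tendsto (fun i => d.state (d.sub i) c z) atTop (𝓝 (d.P c z)) :=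
  ae_all_iff.mpr d.ae_tendsto_P

/-- The limit state `qt + P(z)`. [folklore] -/
def limState (z : ST) : State := d.qt + fun c => d.P c z

/-- Coordinates of the limit state. [folklore] -/
theorem limState_apply (z : ST) (c : Fin 4) : d.limState z c = d.qt c + d.P c z := rfl

/-- The state vectors converge a.e. to the limit state. [folklore] -/
theorem ae_tendsto_stateOf :
    ∀ᵐ z, Tendsto (fun i => stateOf d.qt (d.state (d.sub i)) z) atTop (𝓝 (d.limState z)) := by
  filter_upwards [d.ae_tendsto_P_all] with z hz
  rw [tendsto_pi_nhds]
  intro c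
  simp only [stateOf_apply, limState_apply]
  exact (hz c).const_add _

/-- **Pointwise properties of the limit:** bounded, vanishing off `Ω`, with `M ⪰ 0`. [folklore] -/
theorem ae_limit_props : ∀ᵐ z, (∀ c, |d.P c z| ≤ d.R) ∧ (z ∉ d.Ω → ∀ c, d.P c z = 0)
    ∧ InUbar d.C (d.limState z) := by
  filter_upwards [d.ae_tendsto_P_all, d.ae_tendsto_stateOf] with z hz hS
  refine ⟨fun c => ?_, fun hzΩ c => ?_, ?_⟩
  · exact le_of_tendsto' ((hz c).abs) fun i => d.abs_state_le _ c z
  · have : (fun i => d.state (d.sub i) c z) = fun _ => 0 := funext fun i => d.state_eq_zero _ hzΩ c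
    have h := hz c
    rw [this] at h
    exact tendsto_nhds_unique h tendsto_const_nhds ▸ rfl
  · exact (isClosed_setOf_inUbar d.C).mem_of_tendsto hS
      (Eventually.of_forall fun i => ((d.state_memX0 _).inU z).inUbar)


/-- **The limit saturates the constraint:** `tr M(qt + P) = 0`, i.e. `|ṽ + v̲|² = C`, a.e. on `Ω`
(from `J_{φ i} → 0` by dominated convergence and `M ⪰ 0`). [cite: ChiodaroliDeLellisKreml2015, §4.1 ((Con) ⇒ (iii))] -/
theorem ae_trM_limState_eq_zero : ∀ᵐ z ∂(volume.restrict d.Ω), trM d.C (d.limState z) = 0 := by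
  set μ := volume.restrict d.Ω
  have hΩ : volume d.Ω < ⊤ := d.hΩb.measure_lt_top
  haveI : IsFiniteMeasure μ := isFiniteMeasure_restrict.mpr hΩ.ne
  -- dominated convergence for the trace densities on `Ω`
  have hF : ∀ i, AEStronglyMeasurable (fun z => trM d.C (stateOf d.qt (d.state (d.sub i)) z)) μ :=
    fun i => ((continuous_trM d.C).comp (d.state_memX0 _).continuous_stateOf).aestronglyMeasurable
  have hbound : ∀ i, ∀ᵐ z ∂μ, ‖trM d.C (stateOf d.qt (d.state (d.sub i)) z)‖ ≤ d.C := by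
    intro i
    refine Eventually.of_forall fun z => ?_
    have h1 := ((d.state_memX0 (d.sub i)).inU z).1
    have h2 : trM d.C (stateOf d.qt (d.state (d.sub i)) z) ≤ d.C := by
      rw [trM_eq]; nlinarith [sq_nonneg (stateOf d.qt (d.state (d.sub i)) z 0),
        sq_nonneg (stateOf d.qt (d.state (d.sub i)) z 1)]
    rw [Real.norm_eq_abs, abs_of_pos h1]; exact h2
  have hlim : ∀ᵐ z ∂μ, Tendsto (fun i => trM d.C (stateOf d.qt (d.state (d.sub i)) z)) atTop
      (𝓝 (trM d.C (d.limState z))) := by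
    filter_upwards [ae_restrict_of_ae (s := d.Ω) d.ae_tendsto_stateOf] with z hz
    exact ((continuous_trM d.C).tendsto _).comp hz
  have hDCT := tendsto_integral_of_dominated_convergence (fun _ => d.C) hF (integrable_const d.C)
    hbound hlim
  -- the integrals are the defects `J (φ i) → 0`
  have hJ : Tendsto (fun i => ∫ z, trM d.C (stateOf d.qt (d.state (d.sub i)) z) ∂μ) atTop (𝓝 0) :=
    d.tendsto_J.comp d.tendsto_sub
  have h0 : ∫ z, trM d.C (d.limState z) ∂μ = 0 := tendsto_nhds_unique hDCT hJ
  -- a non-negative function with zero integral vanishes a.e.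
  have hnonneg : 0 ≤ᵐ[μ] fun z => trM d.C (d.limState z) := by
    filter_upwards [ae_restrict_of_ae (s := d.Ω) d.ae_limit_props] with z hz
    exact hz.2.2.trM_nonneg
  have hmeas : AEStronglyMeasurable (fun z => trM d.C (d.limState z)) μ := by
    refine ((continuous_trM d.C).measurable.comp ?_).aestronglyMeasurable
    exact measurable_const.add (measurable_pi_lambda _ fun c => d.measurable_P c)
  have hint : Integrable (fun z => trM d.C (d.limState z)) μ := by
    refine Integrable.mono' (integrable_const (d.C + d.R ^ 2 + d.R ^ 2 + |d.C|)) hmeas ?_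
    filter_upwards [ae_restrict_of_ae (s := d.Ω) d.ae_limit_props] with z hz
    rw [Real.norm_eq_abs, trM_eq]
    simp only [limState_apply]
    have b0 := hz.1 0
    have b1 := hz.1 1
    have hnn := hz.2.2.trM_nonneg
    rw [trM_eq] at hnn
    simp only [limState_apply] at hnn
    rw [abs_of_nonneg hnn]
    nlinarith [abs_nonneg (d.C), le_abs_self d.C, sq_nonneg (d.qt 0 + d.P 0 z), sq_nonneg (d.qt 1 + d.P 1 z),
      sq_nonneg d.R]
  exact (integral_eq_zero_iff_of_nonneg_ae hnonneg hint).mp h0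

/-- Dominated convergence for pairings of the states against a fixed integrable amplitude.
[folklore] -/
theorem tendsto_integral_state_mul (c : Fin 4) {h : ST → ℝ} (hh : Integrable h) :
    Tendsto (fun i => ∫ z, d.state (d.sub i) c z * h z) atTop (𝓝 (∫ z, d.P c z * h z)) := by
  refine tendsto_integral_of_dominated_convergence (fun z => d.R * |h z|) ?_ (hh.abs.const_mul _) ?_ ?_
  · exact fun i => ((d.state_continuous _ c).aestronglyMeasurable.mul hh.aestronglyMeasurable)
  · intro i
    refine Eventually.of_forall fun z => ?_
    rw [Real.norm_eq_abs, abs_mul]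
    exact mul_le_mul_of_nonneg_right (d.abs_state_le _ c z) (abs_nonneg _)
  · filter_upwards [d.ae_tendsto_P c] with z hz
    exact hz.mul_const _

/-- The pairings against a fixed integrable amplitude of the limit are bounded by those of the
states. [folklore] -/
theorem integrable_P_mul (c : Fin 4) {h : ST → ℝ} (hh : Integrable h) :
    Integrable (fun z => d.P c z * h z) := by
  refine Integrable.mono' (hh.abs.const_mul d.R) ((d.measurable_P c).aestronglyMeasurable.mul
    hh.aestronglyMeasurable) ?_
  filter_upwards [d.ae_limit_props] with z hz
  rw [Real.norm_eq_abs, abs_mul]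
  exact mul_le_mul_of_nonneg_right (hz.1 c) (abs_nonneg _)

/-- **Weak form of `div_x v̲ = 0` for the limit.** [cite: ChiodaroliDeLellisKreml2015, Lemma 3.7 (ii)] -/
theorem limit_weak_div {φ : ST → ℝ} (hφ : ContDiff ℝ 1 φ) (hφc : HasCompactSupport φ) :
    ∫ z, (d.P 0 z * pd (dX 0) φ z + d.P 1 z * pd (dX 1) φ z) = 0 := by
  have hi : ∀ e, Integrable (pd e φ) := fun e =>
    (continuous_pd hφ e).integrable_of_hasCompactSupport (hasCompactSupport_pd hφc e)
  have hlim := (d.tendsto_integral_state_mul 0 (hi (dX 0))).add (d.tendsto_integral_state_mul 1 (hi (dX 1)))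
  have hseq : ∀ i, (∫ z, d.state (d.sub i) 0 z * pd (dX 0) φ z) + (∫ z, d.state (d.sub i) 1 z * pd (dX 1) φ z) = 0 := by
    intro i
    rw [← integral_add (d.integrable_state_mul (continuous_pd hφ _)) (d.integrable_state_mul (continuous_pd hφ _))]
    exact (d.state_memX0 _).solves.weak_div (d.state_memX0 _).smooth (d.state_memX0 _).hasCompactSupport hφ
  simp_rw [hseq] at hlim
  rw [integral_add (d.integrable_P_mul 0 (hi _)) (d.integrable_P_mul 1 (hi _))]
  exact (tendsto_nhds_unique hlim tendsto_const_nhds)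

/-- **Weak form of the first momentum equation for the limit.** [cite: ChiodaroliDeLellisKreml2015, Lemma 3.7 (ii)] -/
theorem limit_weak_mom₁ {φ : ST → ℝ} (hφ : ContDiff ℝ 1 φ) (hφc : HasCompactSupport φ) :
    ∫ z, (d.P 0 z * pd dT φ z + d.P 2 z * pd (dX 0) φ z + d.P 3 z * pd (dX 1) φ z) = 0 := by
  have hi : ∀ e, Integrable (pd e φ) := fun e =>
    (continuous_pd hφ e).integrable_of_hasCompactSupport (hasCompactSupport_pd hφc e)
  have hlim := ((d.tendsto_integral_state_mul 0 (hi dT)).add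
    (d.tendsto_integral_state_mul 2 (hi (dX 0)))).add (d.tendsto_integral_state_mul 3 (hi (dX 1)))
  have hseq : ∀ i, (∫ z, d.state (d.sub i) 0 z * pd dT φ z) + (∫ z, d.state (d.sub i) 2 z * pd (dX 0) φ z)
      + (∫ z, d.state (d.sub i) 3 z * pd (dX 1) φ z) = 0 := by
    intro i
    rw [← integral_add_add (d.integrable_state_mul (continuous_pd hφ _))
      (d.integrable_state_mul (continuous_pd hφ _)) (d.integrable_state_mul (continuous_pd hφ _))]
    exact (d.state_memX0 _).solves.weak_mom₁ (d.state_memX0 _).smooth (d.state_memX0 _).hasCompactSupport hφ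
  simp_rw [hseq] at hlim
  rw [integral_add_add (d.integrable_P_mul 0 (hi _)) (d.integrable_P_mul 2 (hi _)) (d.integrable_P_mul 3 (hi _))]
  exact (tendsto_nhds_unique hlim tendsto_const_nhds)

/-- **Weak form of the second momentum equation for the limit.** [cite: ChiodaroliDeLellisKreml2015, Lemma 3.7 (ii)] -/
theorem limit_weak_mom₂ {φ : ST → ℝ} (hφ : ContDiff ℝ 1 φ) (hφc : HasCompactSupport φ) :
    ∫ z, (d.P 1 z * pd dT φ z + d.P 3 z * pd (dX 0) φ z - d.P 2 z * pd (dX 1) φ z) = 0 := by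
  have hi : ∀ e, Integrable (pd e φ) := fun e =>
    (continuous_pd hφ e).integrable_of_hasCompactSupport (hasCompactSupport_pd hφc e)
  have hlim := ((d.tendsto_integral_state_mul 1 (hi dT)).add
    (d.tendsto_integral_state_mul 3 (hi (dX 0)))).sub (d.tendsto_integral_state_mul 2 (hi (dX 1)))
  have hseq : ∀ i, (∫ z, d.state (d.sub i) 1 z * pd dT φ z) + (∫ z, d.state (d.sub i) 3 z * pd (dX 0) φ z)
      - (∫ z, d.state (d.sub i) 2 z * pd (dX 1) φ z) = 0 := by
    intro i
    have i12 : Integrable (fun z => d.state (d.sub i) 1 z * pd dT φ z + d.state (d.sub i) 3 z * pd (dX 0) φ z) :=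
      (d.integrable_state_mul (continuous_pd hφ _)).add (d.integrable_state_mul (continuous_pd hφ _))
    rw [← integral_add (d.integrable_state_mul (continuous_pd hφ _)) (d.integrable_state_mul (continuous_pd hφ _)),
      ← integral_sub i12 (d.integrable_state_mul (continuous_pd hφ _))]
    exact (d.state_memX0 _).solves.weak_mom₂ (d.state_memX0 _).smooth (d.state_memX0 _).hasCompactSupport hφ
  simp_rw [hseq] at hlim
  have i12 : Integrable (fun z => d.P 1 z * pd dT φ z + d.P 3 z * pd (dX 0) φ z) :=
    (d.integrable_P_mul 1 (hi _)).add (d.integrable_P_mul 3 (hi _))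
  rw [integral_sub i12 (d.integrable_P_mul 2 (hi _)), integral_add (d.integrable_P_mul 1 (hi _)) (d.integrable_P_mul 3 (hi _))]
  exact (tendsto_nhds_unique hlim tendsto_const_nhds)

/-- **The observable of the limit:** `|∫ (P_c - p₀,c) g| ≤ θ` for the observed component `c`.
[folklore] -/
theorem abs_integral_obs_le : |∫ z, (d.P d.cobs z - d.p₀ d.cobs z) * d.g z| ≤ d.θ := by
  have hgi : Integrable d.g := d.hg.continuous.integrable_of_hasCompactSupport d.hgc
  -- along the sequence: telescoping and near-orthogonality
  have hseq : ∀ k, |∫ z, (d.state k d.cobs z - d.p₀ d.cobs z) * d.g z| ≤ d.θ := by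
    intro k
    have htel : ∀ z, d.state k d.cobs z - d.p₀ d.cobs z = ∑ j ∈ Finset.range k, d.incr j d.cobs z := by
      intro z
      rw [← d.state_zero]
      rw [← Finset.sum_range_sub (fun j => d.state j d.cobs z) k]
      refine Finset.sum_congr rfl fun j _ => ?_
      rw [d.incr_eq_sub]
    have : (fun z => (d.state k d.cobs z - d.p₀ d.cobs z) * d.g z)
        = fun z => ∑ j ∈ Finset.range k, d.incr j d.cobs z * d.g z := by
      funext z; rw [htel, Finset.sum_mul]
    rw [this, integral_finsetSum _ fun j _ => d.integrable_incr_mul d.hg.continuous]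
    calc |∑ j ∈ Finset.range k, ∫ z, d.incr j d.cobs z * d.g z|
        ≤ ∑ j ∈ Finset.range k, |∫ z, d.incr j d.cobs z * d.g z| := Finset.abs_sum_le_sum_abs _ _
      _ ≤ ∑ j ∈ Finset.range k, d.eps j := Finset.sum_le_sum fun j _ => d.incr_orth_obs j d.cobs
      _ ≤ d.θ := d.sum_eps_le _
  -- pass to the limit along the subsequence
  have hlim : Tendsto (fun i => ∫ z, (d.state (d.sub i) d.cobs z - d.p₀ d.cobs z) * d.g z) atTop
      (𝓝 (∫ z, (d.P d.cobs z - d.p₀ d.cobs z) * d.g z)) := by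
    have h1 := (d.tendsto_integral_state_mul d.cobs hgi).sub_const (∫ z, d.p₀ d.cobs z * d.g z)
    have ip0 : Integrable (fun z => d.p₀ d.cobs z * d.g z) := by
      rw [← d.state_zero]; exact d.integrable_state_mul d.hg.continuous
    refine h1.congr' (Eventually.of_forall fun i => ?_) |>.trans ?_
    · simp only [sub_mul]
      rw [integral_sub (d.integrable_state_mul d.hg.continuous) ip0]
    · simp only [sub_mul]
      rw [integral_sub (d.integrable_P_mul d.cobs hgi) ip0]
  exact le_of_tendsto' hlim.abs fun i => hseq _

end IterData

end Literature.Analysis.FluidPDE.ConvexIntegration
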